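import Summits.HubbardSuperconductivity.HubbardSuperconductivity.Theorems.AnisotropyChordTransferFibre3RateLemma

/-!
# Route `AnisotropyChord` / H0 rotor rung: PartN39 — the HARMONIC-SUPPORT LEMMA (discrete maximum principle), PROVED

PORT PartN39 (`…Fibre3RateLemma`, namespace `HarmonicSupport`; theory seat `hubbard-h0-rotor-theory-1` g21, memo 21 §317(a)(i))
types `HarmonicSupport.Statement`: if `a : ℤ² → ℝ` is harmonic off the origin and `x` solves the boundary system
`Σ_{y ∈ B} a(p − y) x_y = 1` on `B = outer ζ`, then the identity also holds on `ζ` (whence `(A⁻¹1)|_ζ = 0`, `κ_ζ = 1/|B(ζ)|`,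
the Perron identity of §314).  This file proves it (`statement_holds`): `f(p) := Σ_{y∈B} a(p − y)x_y − 1` is discretely
harmonic at every `p ∈ ζ` (harmonicity of `a` at `p − y ≠ 0`), vanishes on `B`, and every neighbour of `ζ` lies in `ζ ∪ B`;
the maximum principle (`max_principle`: at a maximiser of `f` on `ζ` with largest first coordinate the east neighbour is
strictly below the maximum if the maximum is positive) applied to `f` and `−f` gives `f = 0` on `ζ`.
Prover seat `hubbard-h0-rotor-p2` g0; helper for stmt-HubbardSuperconductivity-19089 (`--supports`, helper class).
WHAT THIS IS NOT: nothing here proves superconductivity in the Hubbard model; helper lemma of ONE conditional reduction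
(rung 19089, HOLE₂(.75) far-pair skeleton).  Mathlib + tree imports only; no sorry, no axioms.
-/

set_option linter.dupNamespace false

noncomputable section

namespace Summit.HubbardSuperconductivity.HubbardSuperconductivity.Theorems.AnisotropyChord.Transfer.Fibre3

namespace HarmonicSupport

open Finset

/-- the neighbour sum written out (the four neighbours are distinct). -/
theorem sum_nbrs (g : ℤ × ℤ → ℝ) (z : ℤ × ℤ) :
    ∑ w ∈ nbrs z, g w = g (z.1 + 1, z.2) + g (z.1 - 1, z.2) + g (z.1, z.2 + 1) + g (z.1, z.2 - 1) := by
  unfold nbrs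
  rw [Finset.sum_insert, Finset.sum_insert, Finset.sum_insert, Finset.sum_singleton]
  · ring
  · simp only [Finset.mem_singleton, Prod.mk.injEq]; omega
  · simp only [Finset.mem_insert, Finset.mem_singleton, Prod.mk.injEq]; omega
  · simp only [Finset.mem_insert, Finset.mem_singleton, Prod.mk.injEq]; omega

/-- membership in `nbrs`. -/
theorem mem_nbrs (z w : ℤ × ℤ) :
    w ∈ nbrs z ↔ w = (z.1 + 1, z.2) ∨ w = (z.1 - 1, z.2) ∨ w = (z.1, z.2 + 1) ∨ w = (z.1, z.2 - 1) := by
  unfold nbrs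
  simp only [Finset.mem_insert, Finset.mem_singleton]

/-- every neighbour of a point of `ζ` lies in `ζ` or in `outer ζ`. -/
theorem nbr_mem_or (ζ : Finset (ℤ × ℤ)) (p : ℤ × ℤ) (hp : p ∈ ζ) (w : ℤ × ℤ) (hw : w ∈ nbrs p) :
    w ∈ ζ ∨ w ∈ outer ζ := by
  by_cases h : w ∈ ζ
  · exact Or.inl h
  · right
    unfold outer
    rw [Finset.mem_sdiff, Finset.mem_biUnion]
    exact ⟨⟨p, hp, hw⟩, h⟩

/-- DISCRETE MAXIMUM PRINCIPLE: a function vanishing on `B`, discretely harmonic on a finite set `ζ` whose neighbours lie in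
`ζ ∪ B`, is `≤ 0` on `ζ`. -/
theorem max_principle (ζ B : Finset (ℤ × ℤ)) (hcl : ∀ p ∈ ζ, ∀ w ∈ nbrs p, w ∈ ζ ∨ w ∈ B)
    (g : ℤ × ℤ → ℝ) (hB : ∀ w ∈ B, g w = 0) (hH : ∀ p ∈ ζ, ∑ w ∈ nbrs p, g w = 4 * g p) :
    ∀ p ∈ ζ, g p ≤ 0 := by
  by_contra hcon
  push Not at hcon
  obtain ⟨p₁, hp₁, hpos⟩ := hcon
  have hne : ζ.Nonempty := ⟨p₁, hp₁⟩
  set M := ζ.sup' hne g with hM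
  have hle : ∀ q ∈ ζ, g q ≤ M := fun q hq => Finset.le_sup' g hq
  have hMpos : 0 < M := lt_of_lt_of_le hpos (hle p₁ hp₁)
  -- the set of maximisers and one with largest first coordinate
  set S := ζ.filter (fun q => g q = M) with hS
  have hSne : S.Nonempty := by
    obtain ⟨q, hq, hqM⟩ := Finset.exists_mem_eq_sup' hne g
    exact ⟨q, by rw [hS, Finset.mem_filter]; exact ⟨hq, hqM.symm⟩⟩
  obtain ⟨p, hpS, hpmax⟩ := Finset.exists_max_image S (fun q : ℤ × ℤ => q.1) hSne
  rw [hS, Finset.mem_filter] at hpS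
  obtain ⟨hp, hgp⟩ := hpS
  -- values on neighbours: ≤ M everywhere, < M at the east neighbour
  have hval : ∀ w ∈ nbrs p, g w ≤ M := by
    intro w hw
    rcases hcl p hp w hw with h | h
    · exact hle w h
    · rw [hB w h]; exact hMpos.le
  have heast : g (p.1 + 1, p.2) < M := by
    have hw : (p.1 + 1, p.2) ∈ nbrs p := by rw [mem_nbrs]; exact Or.inl rfl
    rcases hcl p hp _ hw with h | h
    · have hneq : g (p.1 + 1, p.2) ≠ M := by
        intro hEq
        have hmem : (p.1 + 1, p.2) ∈ S := by rw [hS, Finset.mem_filter]; exact ⟨h, hEq⟩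
        have := hpmax _ hmem
        simp at this
      exact lt_of_le_of_ne (hle _ h) hneq
    · rw [hB _ h]; exact hMpos
  have h2 : g (p.1 - 1, p.2) ≤ M := hval _ (by rw [mem_nbrs]; exact Or.inr (Or.inl rfl))
  have h3 : g (p.1, p.2 + 1) ≤ M := hval _ (by rw [mem_nbrs]; exact Or.inr (Or.inr (Or.inl rfl)))
  have h4 : g (p.1, p.2 - 1) ≤ M := hval _ (by rw [mem_nbrs]; exact Or.inr (Or.inr (Or.inr rfl)))
  have hsum := hH p hp
  rw [sum_nbrs, hgp] at hsum
  linarith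

/-- ★ `HarmonicSupport.Statement` holds. -/
theorem statement_holds : Statement := by
  intro a ha ζ x hx p hp
  set B := outer ζ with hBdef
  set f : ℤ × ℤ → ℝ := fun q => (∑ y ∈ B, a (q - y) * x y) - 1 with hf
  -- f vanishes on B
  have hfB : ∀ w ∈ B, f w = 0 := by
    intro w hw; simp only [hf]; rw [hx w hw]; ring
  -- B is disjoint from ζ
  have hdisj : ∀ y ∈ B, y ∉ ζ := by
    intro y hy
    rw [hBdef] at hy; unfold outer at hy
    exact (Finset.mem_sdiff.1 hy).2
  -- f is harmonic on ζ
  have hH : ∀ q ∈ ζ, ∑ w ∈ nbrs q, f w = 4 * f q := by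
    intro q hq
    have hterm : ∀ y ∈ B,
        a ((q.1 + 1, q.2) - y) * x y + a ((q.1 - 1, q.2) - y) * x y + a ((q.1, q.2 + 1) - y) * x y
          + a ((q.1, q.2 - 1) - y) * x y = 4 * (a (q - y) * x y) := by
      intro y hy
      have hqy : q - y ≠ 0 := by
        intro h
        have : q = y := sub_eq_zero.1 h
        exact hdisj y hy (this ▸ hq)
      have hharm := ha (q - y) hqy
      rw [sum_nbrs] at hharm
      have e1 : ((q.1 + 1, q.2) : ℤ × ℤ) - y = ((q - y).1 + 1, (q - y).2) :=
        Prod.ext (by simp only [Prod.fst_sub]; omega) (by simp only [Prod.snd_sub])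
      have e2 : ((q.1 - 1, q.2) : ℤ × ℤ) - y = ((q - y).1 - 1, (q - y).2) :=
        Prod.ext (by simp only [Prod.fst_sub]; omega) (by simp only [Prod.snd_sub])
      have e3 : ((q.1, q.2 + 1) : ℤ × ℤ) - y = ((q - y).1, (q - y).2 + 1) :=
        Prod.ext (by simp only [Prod.fst_sub]) (by simp only [Prod.snd_sub]; omega)
      have e4 : ((q.1, q.2 - 1) : ℤ × ℤ) - y = ((q - y).1, (q - y).2 - 1) :=
        Prod.ext (by simp only [Prod.fst_sub]) (by simp only [Prod.snd_sub]; omega)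
      rw [e1, e2, e3, e4]
      calc _ = (a ((q - y).1 + 1, (q - y).2) + a ((q - y).1 - 1, (q - y).2) + a ((q - y).1, (q - y).2 + 1)
            + a ((q - y).1, (q - y).2 - 1)) * x y := by ring
        _ = 4 * a (q - y) * x y := by rw [hharm]
        _ = 4 * (a (q - y) * x y) := by ring
    have hsum4 : (∑ y ∈ B, a ((q.1 + 1, q.2) - y) * x y) + (∑ y ∈ B, a ((q.1 - 1, q.2) - y) * x y)
        + (∑ y ∈ B, a ((q.1, q.2 + 1) - y) * x y) + (∑ y ∈ B, a ((q.1, q.2 - 1) - y) * x y)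
        = 4 * ∑ y ∈ B, a (q - y) * x y := by
      rw [← Finset.sum_add_distrib, ← Finset.sum_add_distrib, ← Finset.sum_add_distrib, Finset.mul_sum]
      exact Finset.sum_congr rfl hterm
    rw [sum_nbrs]
    simp only [hf]
    linarith [hsum4]
  -- neighbour closure
  have hcl : ∀ q ∈ ζ, ∀ w ∈ nbrs q, w ∈ ζ ∨ w ∈ B := fun q hq w hw => nbr_mem_or ζ q hq w hw
  -- maximum principle for f and −f
  have h1 := max_principle ζ B hcl f hfB hH p hp
  have h2 := max_principle ζ B hcl (fun q => -f q) (fun w hw => by simp [hfB w hw])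
    (fun q hq => by rw [Finset.sum_neg_distrib, hH q hq]; ring) p hp
  have hf0 : f p = 0 := by linarith
  simp only [hf] at hf0
  linarith

end HarmonicSupport

end Summit.HubbardSuperconductivity.HubbardSuperconductivity.Theorems.AnisotropyChord.Transfer.Fibre3

end
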